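import Literature.NumberTheory.EllipticCurves.KatoChiPartVersusChiQuotient
import Literature.NumberTheory.EllipticCurves.KatoTwistedFinitenessProofs
import Literature.NumberTheory.EllipticCurves.MordellWeilTheoremProofs
import Mathlib.GroupTheory.FiniteAbelian.Basic
import HarnessLib

/-!
# Kato's Cor. 14.3 (2) over `ℚ(ζ_m)` in `χ`-quotient form

K. Kato, *`p`-adic Hodge theory and values of zeta functions of modular forms*, Astérisque 295
(2004), Cor. 14.3 (2) (p. 235): for `A/ℚ` a quotient of `J₁(N)`, `K/ℚ` finite abelian and a
character `χ` of `G = Gal(K/ℚ)` with `L(A, χ, 1) ≠ 0`, the `χ`-part `A(K)^(χ)` is finite; and the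
remark after it (p. 236): *"We can replace the "`χ`-parts" […] `A(K)^(χ)` in 14.2 and 14.3 by the
"`χ`-quotients" […] `A(K)_(χ)`, respectively, where `M_(χ) = M/I_χ M` for a `G`-module `M`. This
is because the kernel and the cokernel of the canonical map `M^(χ) → M_(χ)` are killed by some
non-zero integer, and because for `M =` […] `A(K)`, the kernel and the cokernel of `n : M → M`
are finite for any non-zero integer `n`."*

The `χ`-part statement for `A = E` an elliptic curve over `ℚ` and `K = ℚ(ζ_m)` is the tree's
cited named fact `kato_finite_chiPart_of_twistedLValue_ne_zero` (`KatoTwistedFiniteness.lean`;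
all `m` by `KatoTwistedFinitenessProofs.lean`). This file PROVES the passage to `χ`-quotients:

* `finite_quotient_closure_of_finite_chiPart`, `finite_chiPart_of_finite_quotient_closure`,
  `finite_chiPart_iff_finite_quotient_closure` — for a finitely generated abelian group `M`
  with a `ℤ`-linear action of a finite abelian group `G` and a character `χ` (values in a field
  of characteristic zero), `M^(χ)` is finite iff `M_(χ) = M ⧸ I_χ M` is finite. Proof: by
  `KatoChiPartVersusChiQuotient.lean` the kernel and cokernel of `M^(χ) → M ⧸ I_χ M` are killed
  by `#G`; a finitely generated abelian group all of whose elements have finite order is finite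
  (Mathlib `AddCommGroup.finite_of_fg_torsion`), and subgroups/quotients of finitely generated
  abelian groups are finitely generated.
* `kato_finite_chiQuotient_of_twistedLValue_ne_zero` — **Cor. 14.3 (2), `χ`-quotient form**:
  under the hypotheses of the named fact (every `m ≥ 1`, `χ` a Dirichlet character mod `m`,
  `L_{prime(m)}(f, χ, 1) ≠ 0` for the newform `f` of `E`), the `χ`-quotient
  `E(ℚ(ζ_m)) ⧸ I_χ E(ℚ(ζ_m))` is finite — from the named fact, the equivalence above applied to
  the Galois action `σ ↦ Point.map σ` (a `ℤ`-linear representation of the abelian group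
  `Gal(ℚ(ζ_m)/ℚ)`, Mathlib `IsCyclotomicExtension.isMulCommutative`), and the Mordell–Weil
  theorem over number fields, PROVED in the tree (`WeierstrassCurve.module_finite_point_holds`,
  `MordellWeilTheoremProofs.lean`). Here `I_χ E(K)` is spelled, like `chiPart`, with finitely
  supported integer vectors `a` on `Gal(K/ℚ)`: the subgroup generated by the
  `∑ a_σ σ(z)` with `∑ a_σ χ(σ) = 0`.

## What is NOT here

* The `χ`-quotient versions of Thm. 14.2 and Cor. 14.3 (1) (Selmer groups): the `Gal(K/ℚ)`-action
  on the tree's Selmer groups is not available (see `KatoTwistedFiniteness.lean`).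

## References

* K. Kato, *`p`-adic Hodge theory and values of zeta functions of modular forms*, Astérisque 295
  (2004), 117–290, Cor. 14.3 (2) (p. 235) and the remark following it (p. 236).
  [Kato2004Asterisque]
* J. H. Silverman, *The arithmetic of elliptic curves*, GTM 106, Thm. VIII.6.7 (Mordell–Weil).
-/

noncomputable section

namespace Literature.NumberTheory.EllipticCurves

/-! ### `M^(χ)` finite iff `M ⧸ I_χ M` finite, for finitely generated `M` -/

section Algebra

variable {G : Type*} [CommGroup G] [Fintype G] {K : Type*} [Field K] [CharZero K]
variable {M : Type*} [AddCommGroup M]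

omit [Fintype G] [CharZero K] in
/-- A subgroup of a finitely generated abelian group is finitely generated (`ℤ` is Noetherian).
[folklore] -/
theorem addGroup_fg_addSubgroup_of_module_finite [Module.Finite ℤ M] (H : AddSubgroup M) :
    AddGroup.FG H := by
  rw [AddGroup.fg_iff_addSubgroup_fg, ← AddSubgroup.toIntSubmodule_toAddSubgroup H,
    ← Submodule.fg_iff_addSubgroup_fg]
  exact IsNoetherian.noetherian _

/-- **`χ`-quotient finite from `χ`-part finite.** For a finitely generated abelian group `M`
with a `ℤ`-linear action `ρ` of a finite abelian group `G` and a character `χ`: if `M^(χ)` is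
finite then so is `M ⧸ I_χ M` (`I_χ M` = the subgroup generated by the `a · z`, `χ(a) = 0`).
Indeed `M ⧸ I_χ M` is finitely generated and torsion: `#G · x ∈ M^(χ) + I_χ M`
(`card_smul_mem_chiPart_sup_closure`) and the image of the finite group `M^(χ)` in the quotient
consists of elements of finite order. (Kato, Astérisque 295, remark p. 236, the algebraic
half.) [cite: Kato2004Asterisque, §14 remark after Cor. 14.3 (p. 236)] -/
theorem finite_quotient_closure_of_finite_chiPart [Module.Finite ℤ M] (ρ : Representation ℤ G M)
    (χ : G →* K) (h : Finite (chiPart (fun g => (ρ g).toAddMonoidHom) χ)) :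
    Finite (M ⧸ AddSubgroup.closure {y : M | ∃ a : MonoidAlgebra ℤ G,
        MonoidAlgebra.lift ℤ K G χ a = 0 ∧ ∃ z : M, y = ρ.asAlgebraHom a z}) := by
  set I := AddSubgroup.closure {y : M | ∃ a : MonoidAlgebra ℤ G,
        MonoidAlgebra.lift ℤ K G χ a = 0 ∧ ∃ z : M, y = ρ.asAlgebraHom a z} with hI
  set C := chiPart (fun g => (ρ g).toAddMonoidHom) χ with hC
  haveI : AddGroup.FG M := Module.Finite.iff_addGroup_fg.mp inferInstance
  haveI : Finite C := h
  -- the image of `C` in `M ⧸ I` is finite, and `#G` pushes everything into it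
  haveI : Finite (C.map (QuotientAddGroup.mk' I)) :=
    Finite.of_surjective (fun x : C => (⟨QuotientAddGroup.mk' I x, x, x.2, rfl⟩ :
      C.map (QuotientAddGroup.mk' I))) fun ⟨y, x, hx, hxy⟩ => ⟨⟨x, hx⟩, Subtype.ext hxy⟩
  refine AddCommGroup.finite_of_fg_torsion (M ⧸ I) fun q => ?_
  obtain ⟨x, rfl⟩ := QuotientAddGroup.mk_surjective q
  have hmem : (Fintype.card G : ℤ) • x ∈ C ⊔ I := card_smul_mem_chiPart_sup_closure ρ χ x
  obtain ⟨c, hc, i, hi, hci⟩ := AddSubgroup.mem_sup.mp hmem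
  have hq : (Fintype.card G) • (QuotientAddGroup.mk x : M ⧸ I) = QuotientAddGroup.mk c := by
    rw [← natCast_zsmul, ← QuotientAddGroup.mk_zsmul, ← hci, QuotientAddGroup.mk_add,
      (QuotientAddGroup.eq_zero_iff i).mpr hi, add_zero]
  have hfin : IsOfFinAddOrder
      (⟨QuotientAddGroup.mk c, c, hc, rfl⟩ : C.map (QuotientAddGroup.mk' I)) :=
    isOfFinAddOrder_of_finite _
  obtain ⟨n, hn, hnc⟩ := (isOfFinAddOrder_iff_nsmul_eq_zero).mp hfin
  have hnc' : n • (QuotientAddGroup.mk c : M ⧸ I) = 0 := congrArg Subtype.val hnc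
  refine (isOfFinAddOrder_iff_nsmul_eq_zero).mpr
    ⟨n * Fintype.card G, Nat.mul_pos hn Fintype.card_pos, ?_⟩
  rw [mul_nsmul', hq, hnc']

/-- **`χ`-part finite from `χ`-quotient finite.** Conversely, if `M ⧸ I_χ M` is finite, of order
`n`, then for `x ∈ M^(χ)` one has `n x ∈ M^(χ) ∩ I_χ M`, which `#G` kills
(`card_smul_eq_zero_of_mem_chiPart_of_mem_closure`); so the finitely generated group `M^(χ)` is
torsion, hence finite. [cite: Kato2004Asterisque, §14 remark after Cor. 14.3 (p. 236)] -/
theorem finite_chiPart_of_finite_quotient_closure [Module.Finite ℤ M] (ρ : Representation ℤ G M)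
    (χ : G →* K) (h : Finite (M ⧸ AddSubgroup.closure {y : M | ∃ a : MonoidAlgebra ℤ G,
        MonoidAlgebra.lift ℤ K G χ a = 0 ∧ ∃ z : M, y = ρ.asAlgebraHom a z})) :
    Finite (chiPart (fun g => (ρ g).toAddMonoidHom) χ) := by
  set I := AddSubgroup.closure {y : M | ∃ a : MonoidAlgebra ℤ G,
        MonoidAlgebra.lift ℤ K G χ a = 0 ∧ ∃ z : M, y = ρ.asAlgebraHom a z} with hI
  set C := chiPart (fun g => (ρ g).toAddMonoidHom) χ with hC
  haveI : AddGroup.FG C := addGroup_fg_addSubgroup_of_module_finite C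
  haveI : Finite (M ⧸ I) := h
  refine AddCommGroup.finite_of_fg_torsion C fun x => ?_
  -- `n = #(M ⧸ I)` pushes `x` into `C ∩ I`, which `#G` kills
  have hn : Nat.card (M ⧸ I) • (QuotientAddGroup.mk (x : M) : M ⧸ I) = 0 := card_nsmul_eq_zero'
  rw [← QuotientAddGroup.mk_nsmul, QuotientAddGroup.eq_zero_iff] at hn
  have hC' : Nat.card (M ⧸ I) • (x : M) ∈ C := C.nsmul_mem x.2 _
  have hkill := card_smul_eq_zero_of_mem_chiPart_of_mem_closure ρ χ hC' hn
  refine (isOfFinAddOrder_iff_nsmul_eq_zero).mpr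
    ⟨Fintype.card G * Nat.card (M ⧸ I), Nat.mul_pos Fintype.card_pos Nat.card_pos, ?_⟩
  apply Subtype.ext
  rw [AddSubgroup.coe_nsmul, AddSubgroup.coe_zero, mul_nsmul', ← natCast_zsmul, hkill]

/-- For a finitely generated abelian group with an action of a finite abelian group, Kato's
`χ`-part `M^(χ)` is finite iff the `χ`-quotient `M ⧸ I_χ M` is (the kernel and cokernel of
`M^(χ) → M ⧸ I_χ M` are killed by `#G`, and multiplication by a non-zero integer on a finitely
generated abelian group has finite kernel and cokernel), as remarked by Kato, Astérisque 295,
p. 236. [cite: Kato2004Asterisque, §14 remark after Cor. 14.3 (p. 236)] -/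
theorem finite_chiPart_iff_finite_quotient_closure [Module.Finite ℤ M] (ρ : Representation ℤ G M)
    (χ : G →* K) :
    Finite (chiPart (fun g => (ρ g).toAddMonoidHom) χ) ↔
      Finite (M ⧸ AddSubgroup.closure {y : M | ∃ a : MonoidAlgebra ℤ G,
        MonoidAlgebra.lift ℤ K G χ a = 0 ∧ ∃ z : M, y = ρ.asAlgebraHom a z}) :=
  ⟨finite_quotient_closure_of_finite_chiPart ρ χ, finite_chiPart_of_finite_quotient_closure ρ χ⟩

end Algebra

/-! ### Kato's Cor. 14.3 (2), `χ`-quotient form, for `E/ℚ` and `K = ℚ(ζ_m)` -/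

section Kato

open ModularForms WeierstrassCurve WeierstrassCurve.Affine CongruenceSubgroup

set_option backward.isDefEq.respectTransparency false in
open scoped Classical IsMulCommutative in
/-- **Kato's Cor. 14.3 (2) in `χ`-quotient form** (K. Kato, Astérisque 295 (2004), Cor. 14.3 (2)
p. 235 with the remark p. 236: "We can replace the `χ`-parts […] `A(K)^(χ)` […] by the
`χ`-quotients […] `A(K)_(χ)` […] where `M_(χ) = M/I_χ M`"). Let `E/ℚ` be an elliptic curve with
newform `f` (`IsNewformOf W f`), `m ≥ 1`, `K = ℚ(ζ_m)`, `χ` a Dirichlet character mod `m` viewed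
on `G = Gal(K/ℚ)` through `cyclotomicCharacterOf`, and assume that the mod-`m` twisted series
`∑ χ(n) aₙ(f) n⁻ˢ = L_{prime(m)}(f, χ, s)` has an entire continuation with `L(1) ≠ 0`. Then,
granting Kato's Cor. 14.3 (2) for `χ`-parts as vendored (the named fact
`kato_finite_chiPart_of_twistedLValue_ne_zero`, hypothesis `hK`; all `m` by
`kato_finite_chiPart_cyclotomic_of_twistedLValue_ne_zero_of`), the `χ`-quotient
`E(K)_(χ) = E(K) ⧸ I_χ E(K)` is finite, where `I_χ E(K)` is the subgroup generated by the
`∑ a_σ σ(z)` (`z ∈ E(K)`, `a = ∑ a_σ σ ∈ ℤ[G]` with `∑ a_σ χ(σ) = 0`). Proof: Kato's own — the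
kernel and cokernel of `E(K)^(χ) → E(K)_(χ)` are killed by `#G` (`KatoChiPartVersusChiQuotient`)
and `E(K)` is finitely generated (Mordell–Weil, `WeierstrassCurve.module_finite_point_holds`) —
through `finite_quotient_closure_of_finite_chiPart` for the `ℤ`-linear representation
`σ ↦ Point.map σ` of the abelian group `Gal(ℚ(ζ_m)/ℚ)`. (The option
`backward.isDefEq.respectTransparency false` identifies the two `ℚ`-algebra structures on
`CyclotomicField m ℚ`, as in `KatoTwistedFiniteness.lean`.)
[cite: Kato2004Asterisque, Cor. 14.3 (2) (p. 235) and remark (p. 236)] -/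
theorem kato_finite_chiQuotient_of_twistedLValue_ne_zero
    (hK : kato_finite_chiPart_of_twistedLValue_ne_zero) (W : WeierstrassCurve ℚ) [W.IsElliptic]
    {N : ℕ} [NeZero N] {f : CuspForm (Gamma0 N) 2} (hf : IsNewformOf W f) {m : ℕ} [NeZero m]
    (χ : DirichletCharacter ℂ m)
    (hL : ∃ L : ℂ → ℂ, Differentiable ℂ L ∧
      (∀ s : ℂ, 2 < s.re → L s = twistedLSeries f χ s) ∧ L 1 ≠ 0) :
    Finite ((W.toAffine ⁄ (CyclotomicField m ℚ)).Point ⧸ AddSubgroup.closure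
      {y | ∃ a : (CyclotomicField m ℚ ≃ₐ[ℚ] CyclotomicField m ℚ) →₀ ℤ,
        (a.sum fun σ n => (n : ℂ) * (cyclotomicCharacterOf χ σ : ℂ)) = 0 ∧
        ∃ z : (W.toAffine ⁄ (CyclotomicField m ℚ)).Point,
          y = a.sum fun σ n => n • Point.map (W' := W.toAffine)
            (σ : CyclotomicField m ℚ →ₐ[ℚ] CyclotomicField m ℚ) z}) := by
  -- `Gal(ℚ(ζ_m)/ℚ)` is abelian
  haveI : IsMulCommutative (CyclotomicField m ℚ ≃ₐ[ℚ] CyclotomicField m ℚ) :=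
    IsCyclotomicExtension.isMulCommutative {m} ℚ (CyclotomicField m ℚ)
  letI : CommGroup (CyclotomicField m ℚ ≃ₐ[ℚ] CyclotomicField m ℚ) := inferInstance
  -- the Galois action on `E(ℚ(ζ_m))` as a `ℤ`-linear representation
  let ρ : Representation ℤ (CyclotomicField m ℚ ≃ₐ[ℚ] CyclotomicField m ℚ)
      (W.toAffine ⁄ (CyclotomicField m ℚ)).Point :=
    { toFun := fun σ => (Point.map (W' := W.toAffine)
        (σ : CyclotomicField m ℚ →ₐ[ℚ] CyclotomicField m ℚ)).toIntLinearMap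
      map_one' := by
        apply LinearMap.ext
        intro P
        change Point.map (W' := W.toAffine) ((1 : CyclotomicField m ℚ ≃ₐ[ℚ] CyclotomicField m ℚ) :
          CyclotomicField m ℚ →ₐ[ℚ] CyclotomicField m ℚ) P = P
        rcases P with _ | ⟨x, y, h⟩ <;> rfl
      map_mul' := fun σ τ => by
        apply LinearMap.ext
        intro P
        change Point.map (W' := W.toAffine)
            ((σ * τ : CyclotomicField m ℚ ≃ₐ[ℚ] CyclotomicField m ℚ) :
              CyclotomicField m ℚ →ₐ[ℚ] CyclotomicField m ℚ) P =
          Point.map (W' := W.toAffine) (σ : CyclotomicField m ℚ →ₐ[ℚ] CyclotomicField m ℚ)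
            (Point.map (W' := W.toAffine) (τ : CyclotomicField m ℚ →ₐ[ℚ] CyclotomicField m ℚ) P)
        rw [Point.map_map]
        rfl }
  let χ' : (CyclotomicField m ℚ ≃ₐ[ℚ] CyclotomicField m ℚ) →* ℂ :=
    (Units.coeHom ℂ).comp (cyclotomicCharacterOf χ)
  -- Kato for `χ`-parts (all `m`), Mordell–Weil, and the passage to `χ`-quotients
  have hfin : Finite (chiPart (fun σ => (ρ σ).toAddMonoidHom) χ') :=
    kato_finite_chiPart_cyclotomic_of_twistedLValue_ne_zero_of hK W hf χ hL
  haveI : (W.toAffine ⁄ (CyclotomicField m ℚ)).IsElliptic := by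
    change (W.map _).IsElliptic
    infer_instance
  haveI : Module.Finite ℤ (W.toAffine ⁄ (CyclotomicField m ℚ)).Point :=
    (W.baseChange (CyclotomicField m ℚ)).module_finite_point_holds
  have key := finite_quotient_closure_of_finite_chiPart ρ χ' hfin
  have hS : {y | ∃ a : MonoidAlgebra ℤ (CyclotomicField m ℚ ≃ₐ[ℚ] CyclotomicField m ℚ),
      MonoidAlgebra.lift ℤ ℂ _ χ' a = 0 ∧ ∃ z, y = ρ.asAlgebraHom a z} =
      {y | ∃ a : (CyclotomicField m ℚ ≃ₐ[ℚ] CyclotomicField m ℚ) →₀ ℤ,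
        (a.sum fun σ n => (n : ℂ) * (cyclotomicCharacterOf χ σ : ℂ)) = 0 ∧
        ∃ z : (W.toAffine ⁄ (CyclotomicField m ℚ)).Point,
          y = a.sum fun σ n => n • Point.map (W' := W.toAffine)
            (σ : CyclotomicField m ℚ →ₐ[ℚ] CyclotomicField m ℚ) z} := by
    ext y
    simp only [Set.mem_setOf_eq, MonoidAlgebra.exists, lift_ofCoeff_eq_sum,
      asAlgebraHom_ofCoeff_apply]
    rfl
  rw [hS] at key
  exact key

end Kato

end Literature.NumberTheory.EllipticCurves

end
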